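import Summits.HodgeConjecture.CorCM.SexticOcticSlotCommonConstituent
import Summits.HodgeConjecture.CorCM.ReflexOcticPairFlips
import Summits.HodgeConjecture.CorCM.PairFlipSexticTimesReflexOcticHodge
import Summits.HodgeConjecture.CorCM.SharedSignCharacterQuadraticSubfield
import Summits.HodgeConjecture.CorCM.PairwiseCMFamiliesHodge
import Literature.NumberTheory.ComplexMultiplication.SharedImaginaryQuadraticFamilies
import Literature.AlgebraicGeometry.ComplexMultiplication.SimpleIffPrimitiveCMType
import Literature.AlgebraicGeometry.Pohlmann1968.NondegenerateCMTypeHodgeConjecture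
import Literature.AlgebraicGeometry.Pohlmann1968.SeparatingCMFamilies
import Literature.AlgebraicGeometry.Pohlmann1968.SimpleCMAbelianVarietyPowersDivisorGenerated
import HarnessLib

/-!
# The (3,4) cell of dimension seven, complete: a sextic CM slot against an octic CM slot is decided by a shared
# imaginary quadratic field and the reflex Hamming balls — a simple CM abelian threefold times a simple CM abelian
# fourfold

COR-CM (cell `pub-hodgecm2`, binder seat `b16` gen 47, count-neutral claim CM34-COMPLETE, file F9 — the headline;
theorems only, no definition, no named fact, no `sorry`).  NEW as stated, hence under `Summits/`.  HONEST FRAMING: the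
Hodge conjecture for NAMED classes of CM abelian varieties; `HC_CM` is neither used nor asserted.

Let `K_{i₀}` be ANY sextic CM field, `K_{i₁}` ANY octic CM field, `Φ = (Φ_{i₀}, Φ_{i₁})` any CM types (realisations:
a CM abelian threefold `T` and a CM abelian fourfold `F`).  Two configurations are known to be degenerate with both types
nondegenerate: a SHARED IMAGINARY QUADRATIC SUBFIELD (seat b23), and seat b16 gen 45's EXOTIC REFLEX PAIRS — `K_{i₁}`
embedded by `ψ₀` as the reflex field of `(K_{i₀}, Φ_{i₀})` (`Fix(ψ₀) = Stab(Φ_{i₀})` in `Aut(ℂ)`) with `Φ_{i₁}` one of the two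
HAMMING BALLS at `ψ₀` (`ψ₀` and its three flip-neighbours all inside, or all outside, `Φ_{i₁}`).

> **Theorem** (`isNondegenerateFamily_threefold_fourfold_iff`).  `Φ` is nondegenerate (`Hg(T × F) = Hg(T) × Hg(F)`)
> **iff** both types are nondegenerate, no imaginary quadratic subfield of `K_{i₀}` embeds in `K_{i₁}`, and `Φ` is not an
> exotic reflex pair.  THESE ARE THE ONLY OBSTRUCTIONS.

PROOF.  ⟹: b23's shared-quadratic degeneracy; gen 45's ball degeneracy, the pair flips it needs being supplied by the
reflex embedding itself (`ReflexOcticPairFlips`).  ⟸: if a reflex embedding exists, gen 45's dichotomy; otherwise the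
abstract theorem `SexticOctic.shared_eigen_or_reflex` (F7) shows that every common constituent of the two slots is a
shared sign character — an imaginary quadratic subfield of `K_{i₀}` inside `K_{i₁}` (gen 46) — so there is none, and p2's
pairwise criterion gives additivity.

§2 on abelian varieties (`T = A_{i₀}` SIMPLE of dimension `3`, `F = A_{i₁}` of dimension `4`, realisations of the types):
**`isNondegenerateFamily_iff_threefold_fourfold`** (then `Φ_{i₀}` is primitive, hence nondegenerate by Yanai),
**`hodgeConjectureFor_prod_threefold_fourfold`** (the Hodge conjecture and `B• = D•` on EVERY `T^a × F^b`,
UNCONDITIONALLY, off the two named configurations and for `F` nondegenerate), and for `F` simple the sharp forms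
**`forall_prod_hodgeClassSpan_eq_iff_threefold_fourfold`**, **`exists_exceptional_prod_iff_threefold_fourfold`** — the
complete list of exceptional pairs (simple CM threefold, simple CM fourfold).

## References

* [MoonenZarhin1999LowDim] B. Moonen, Yu. Zarhin, *Hodge classes on abelian varieties of low dimension*, Math. Ann.
  315 (1999), Thm. (0.2), Cor. (3.9).
* [Gordon1999HodgeAVSurvey] B. B. Gordon, *A survey of the Hodge conjecture for abelian varieties*, §3, 7.5–7.7, 9.4,
  10.10.
* [Dodson1984] B. Dodson, *The structure of Galois groups of CM-fields*, Trans. AMS 283 (1984), §1.1, §3.3.2, §5.1.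
* [Shimura1998] G. Shimura, *Abelian Varieties with Complex Multiplication and Modular Functions*, §8.3 Prop. 28.
-/

noncomputable section

open CategoryTheory CategoryTheory.Limits NumberField Module
open scoped BigOperators

namespace Summit.HodgeConjecture.CorCM

open Literature.NumberTheory.ComplexMultiplication
open Literature.AlgebraicGeometry.Motives (AbelianVariety CMType)
open Literature.AlgebraicGeometry.HodgeTheory
open Literature.AlgebraicGeometry.ComplexMultiplication (IsCMTypeRealisation isSimple_iff_isPrimitive)
open Literature.AlgebraicGeometry.VanGeemen1994 (hodgeClassSpan)
open Literature.AlgebraicGeometry.Pohlmann1968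
open Literature.Barriers.HodgeConjecture (divisorClassesSpan)

/-! ## §1 CM fields: the sextic slot against the octic slot -/

section Fields

variable {I : Type} {K : I → Type} [∀ i, Field (K i)] [∀ i, NumberField (K i)] [∀ i, IsCMField (K i)]

/-- **No common constituent off the two named configurations.**  `[K_a : ℚ] = 6`, `[K_b : ℚ] = 8`, no imaginary
quadratic `F ≤ K_a` embeds in `K_b`, and NO embedding `ψ₀ : K_b → ℂ` has `Fix(ψ₀) = Stab(Φ_a)`: then the slots `a`, `b`
have no common constituent (both orders) — by `SexticOctic.shared_eigen_or_reflex`, a common constituent would be a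
shared sign character, i.e. a shared imaginary quadratic field, or a reflex embedding.
[cite: Gordon1999HodgeAVSurvey, §3 Theorem (proof)] [cite: Dodson1984, §5.1] -/
theorem pairwise_threefold_fourfold (Φ : ∀ i, CMType (K i)) {a b : I} (ha : finrank ℚ (K a) = 6)
    (hb : finrank ℚ (K b) = 8)
    (hno : ¬ ∃ F : IntermediateField ℚ (K a), finrank ℚ F = 2 ∧ IsTotallyComplex F ∧ Nonempty (F →+* K b))
    (hnorefl : ¬ ∃ ψ₀ : K b →+* ℂ, ∀ σ : ℂ ≃+* ℂ, σ • ψ₀ = ψ₀ ↔ ∀ x : K a →+* ℂ, σ • x ∈ (Φ a).1 ↔ x ∈ (Φ a).1) :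
    (∀ P : Submodule ℚ ((K a →+* ℂ) → ℚ), P ≤ antiSpan (ℂ ≃+* ℂ) (Φ a).1 →
      (∀ g : ℂ ≃+* ℂ, ∀ f ∈ P, (fun x => f (g • x)) ∈ P) →
      ∀ T : ((K a →+* ℂ) → ℚ) →ₗ[ℚ] ((K b →+* ℂ) → ℚ),
        (∀ g : ℂ ≃+* ℂ, ∀ f ∈ P, T (fun x => f (g • x)) = fun y => T f (g • y)) →
        (∀ f ∈ P, T f ∈ antiSpan (ℂ ≃+* ℂ) (Φ b).1) → (∀ f ∈ P, T f = 0 → f = 0) → P = ⊥) ∧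
    (∀ P : Submodule ℚ ((K b →+* ℂ) → ℚ), P ≤ antiSpan (ℂ ≃+* ℂ) (Φ b).1 →
      (∀ g : ℂ ≃+* ℂ, ∀ f ∈ P, (fun x => f (g • x)) ∈ P) →
      ∀ T : ((K b →+* ℂ) → ℚ) →ₗ[ℚ] ((K a →+* ℂ) → ℚ),
        (∀ g : ℂ ≃+* ℂ, ∀ f ∈ P, T (fun x => f (g • x)) = fun y => T f (g • y)) →
        (∀ f ∈ P, T f ∈ antiSpan (ℂ ≃+* ℂ) (Φ a).1) → (∀ f ∈ P, T f = 0 → f = 0) → P = ⊥) := by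
  classical
  have hCM : ∀ i, IsCMTypeWith (starRingAut : ℂ ≃+* ℂ) (Φ i).1 := fun i => isCMTypeWith_conj (Φ i)
  haveI : MulAction.IsPretransitive (ℂ ≃+* ℂ) (K a →+* ℂ) := isPretransitive_ringEquiv_complex
  haveI : MulAction.IsPretransitive (ℂ ≃+* ℂ) (K b →+* ℂ) := isPretransitive_ringEquiv_complex
  have hca : Fintype.card (K a →+* ℂ) = 6 := by rw [Embeddings.card, ha]
  have hcb : Fintype.card (K b →+* ℂ) = 8 := by rw [Embeddings.card, hb]
  -- either disjunct of the abstract theorem contradicts the hypotheses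
  have hout : ¬ ((∃ (χ : (ℂ ≃+* ℂ) → ℚ) (f : (K a →+* ℂ) → ℚ) (f' : (K b →+* ℂ) → ℚ),
      f ∈ antiWeights (E := K a →+* ℂ) (starRingAut : ℂ ≃+* ℂ) ∧
      f' ∈ antiWeights (E := K b →+* ℂ) (starRingAut : ℂ ≃+* ℂ) ∧ f ≠ 0 ∧ f' ≠ 0 ∧
      (∀ g : ℂ ≃+* ℂ, (fun x => f (g • x)) = χ g • f) ∧ ∀ g : ℂ ≃+* ℂ, (fun y => f' (g • y)) = χ g • f') ∨
      ∀ Φ' : Set (K a →+* ℂ), IsCMTypeWith (starRingAut : ℂ ≃+* ℂ) Φ' →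
        ∃ y : K b →+* ℂ, ∀ g : ℂ ≃+* ℂ, g • y = y ↔ ∀ x : K a →+* ℂ, g • x ∈ Φ' ↔ x ∈ Φ') := by
    rintro (⟨χ, f, f', hfa, hf'a, hf0, hf'0, hf, hf'⟩ | hrefl)
    · exact hno (SignCharacter.exists_quadratic_subfield_ringHom_of_shared_eigen χ hf
        (fun x => (mem_antiWeights_iff'.1 hfa) x) hf0 hf' (fun y => (mem_antiWeights_iff'.1 hf'a) y) hf'0)
    · exact hnorefl (hrefl _ (hCM a))
  constructor
  · intro P hP hPst T hT hTU hTinj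
    by_contra hP0
    exact hout (SexticOctic.shared_eigen_or_reflex (hCM a) (hCM b) hca hcb
      (hP.trans (antiSpan_le_antiWeights' (hCM a))) hP0 hPst T hT
      (fun f hf => antiSpan_le_antiWeights' (hCM b) (hTU f hf)) hTinj)
  · intro P hP hPst T hT hTU hTinj
    by_contra hP0
    exact hout (SexticOctic.shared_eigen_or_reflex' (hCM a) (hCM b) hca hcb
      (hP.trans (antiSpan_le_antiWeights' (hCM b))) hP0 hPst T hT
      (fun f hf => antiSpan_le_antiWeights' (hCM a) (hTU f hf)) hTinj)

variable [Fintype I] [DecidableEq I]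

/-- **THE (3,4) CELL.**  `[K_{i₀} : ℚ] = 6`, `[K_{i₁} : ℚ] = 8`, ANY CM types: `(Φ_{i₀}, Φ_{i₁})` is nondegenerate
(`Hg(T × F) = Hg(T) × Hg(F)`) iff both types are nondegenerate, no imaginary quadratic subfield of `K_{i₀}` embeds in
`K_{i₁}`, and the pair is not an exotic reflex pair (`K_{i₁}` embedded as the reflex field of `(K_{i₀}, Φ_{i₀})` by `ψ₀`
with `Φ_{i₁}` a Hamming ball at `ψ₀`). [cite: MoonenZarhin1999LowDim, Thm. (0.2)] [cite: Gordon1999HodgeAVSurvey, §3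
Theorem, 7.5–7.7] [cite: Dodson1984, §3.3.2 and §5.1] [cite: Shimura1998, §8.3 Prop. 28] -/
theorem isNondegenerateFamily_threefold_fourfold_iff {i₀ i₁ : I} (h01 : i₀ ≠ i₁) (hI : ∀ j, j = i₀ ∨ j = i₁)
    (h6 : finrank ℚ (K i₀) = 6) (h8 : finrank ℚ (K i₁) = 8) (Φ : ∀ i, CMType (K i)) :
    CMAlgebra.IsNondegenerateFamily Φ ↔ (∀ i, IsNondegenerate (Φ i)) ∧
      (¬ ∃ F : IntermediateField ℚ (K i₀), finrank ℚ F = 2 ∧ IsTotallyComplex F ∧ Nonempty (F →+* K i₁)) ∧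
      ¬ ∃ ψ₀ : K i₁ →+* ℂ, (∀ σ : ℂ ≃+* ℂ, σ • ψ₀ = ψ₀ ↔ ∀ x : K i₀ →+* ℂ, σ • x ∈ (Φ i₀).1 ↔ x ∈ (Φ i₀).1) ∧
        ((ψ₀ ∈ (Φ i₁).1 ∧ ∀ (x : K i₀ →+* ℂ) (σ : ℂ ≃+* ℂ), x ∈ (Φ i₀).1 →
            σ • x = (starRingAut : ℂ ≃+* ℂ) • x →
            (∀ t : K i₀ →+* ℂ, t ≠ x → t ≠ (starRingAut : ℂ ≃+* ℂ) • x → σ • t = t) → σ • ψ₀ ∈ (Φ i₁).1) ∨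
          (ψ₀ ∉ (Φ i₁).1 ∧ ∀ (x : K i₀ →+* ℂ) (σ : ℂ ≃+* ℂ), x ∈ (Φ i₀).1 →
            σ • x = (starRingAut : ℂ ≃+* ℂ) • x →
            (∀ t : K i₀ →+* ℂ, t ≠ x → t ≠ (starRingAut : ℂ ≃+* ℂ) • x → σ • t = t) → σ • ψ₀ ∉ (Φ i₁).1)) := by
  haveI : Nonempty I := ⟨i₀⟩
  constructor
  · intro hnd
    refine ⟨fun i => hnd.isNondegenerate i, ?_, ?_⟩
    · rintro ⟨F, hF2, hFtc, ⟨j₁⟩⟩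
      haveI := hFtc
      exact not_isNondegenerateFamily_of_shared_imaginary_quadratic (k := ↥F) hF2 h01 (algebraMap (↥F) (K i₀)) j₁
        Φ hnd
    · rintro ⟨ψ₀, hψ₀, hball⟩
      exact not_isNondegenerateFamily_of_reflexOctic_ball h01 hI h6
        (SexticOctic.pairFlip_of_reflexEmbedding h6 h8 (Φ i₀) hψ₀) Φ hψ₀ hball hnd
  · rintro ⟨hnd, hno, hnoball⟩
    by_cases hrefl : ∃ ψ₀ : K i₁ →+* ℂ, ∀ σ : ℂ ≃+* ℂ, σ • ψ₀ = ψ₀ ↔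
        ∀ x : K i₀ →+* ℂ, σ • x ∈ (Φ i₀).1 ↔ x ∈ (Φ i₀).1
    · obtain ⟨ψ₀, hψ₀⟩ := hrefl
      exact (isNondegenerateFamily_iff_of_reflexOctic h01 hI h6
        (SexticOctic.pairFlip_of_reflexEmbedding h6 h8 (Φ i₀) hψ₀) Φ hψ₀).2
        ⟨hnd i₁, fun hb => hnoball ⟨ψ₀, hψ₀, Or.inl hb⟩, fun hb => hnoball ⟨ψ₀, hψ₀, Or.inr hb⟩⟩
    · have hab := pairwise_threefold_fourfold Φ h6 h8 hno hrefl
      refine (isNondegenerateFamily_iff_forall_of_pairwise Φ fun i j hij => ?_).2 hnd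
      rcases hI i with rfl | rfl <;> rcases hI j with rfl | rfl
      · exact absurd rfl hij
      · exact hab.1
      · exact hab.2
      · exact absurd rfl hij

omit [DecidableEq I] in
/-- **The reflex dichotomy of seat b16 gen 45 WITHOUT the pair-flip hypothesis**: for `[K_{i₀} : ℚ] = 6`,
`[K_{i₁} : ℚ] = 8` and a reflex embedding `ψ₀` (`Fix(ψ₀) = Stab(Φ_{i₀})`), the pair flips are automatic
(`ReflexOcticPairFlips`), so `(Φ_{i₀}, Φ_{i₁})` is nondegenerate iff `Φ_{i₁}` is nondegenerate and is neither Hamming ball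
at `ψ₀`. [cite: Dodson1984, §1.1 and §3.3.2] [cite: Shimura1998, §8.3 Prop. 28] -/
theorem isNondegenerateFamily_iff_of_reflexEmbedding {i₀ i₁ : I} (h01 : i₀ ≠ i₁) (hI : ∀ j, j = i₀ ∨ j = i₁)
    (h6 : finrank ℚ (K i₀) = 6) (h8 : finrank ℚ (K i₁) = 8) (Φ : ∀ i, CMType (K i)) {ψ₀ : K i₁ →+* ℂ}
    (hψ₀ : ∀ σ : ℂ ≃+* ℂ, σ • ψ₀ = ψ₀ ↔ ∀ x : K i₀ →+* ℂ, σ • x ∈ (Φ i₀).1 ↔ x ∈ (Φ i₀).1) :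
    CMAlgebra.IsNondegenerateFamily Φ ↔ IsNondegenerate (Φ i₁) ∧
      ¬ (ψ₀ ∈ (Φ i₁).1 ∧ ∀ (x : K i₀ →+* ℂ) (σ : ℂ ≃+* ℂ), x ∈ (Φ i₀).1 →
        σ • x = (starRingAut : ℂ ≃+* ℂ) • x →
        (∀ t : K i₀ →+* ℂ, t ≠ x → t ≠ (starRingAut : ℂ ≃+* ℂ) • x → σ • t = t) → σ • ψ₀ ∈ (Φ i₁).1) ∧
      ¬ (ψ₀ ∉ (Φ i₁).1 ∧ ∀ (x : K i₀ →+* ℂ) (σ : ℂ ≃+* ℂ), x ∈ (Φ i₀).1 →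
        σ • x = (starRingAut : ℂ ≃+* ℂ) • x →
        (∀ t : K i₀ →+* ℂ, t ≠ x → t ≠ (starRingAut : ℂ ≃+* ℂ) • x → σ • t = t) → σ • ψ₀ ∉ (Φ i₁).1) :=
  isNondegenerateFamily_iff_of_reflexOctic h01 hI h6 (SexticOctic.pairFlip_of_reflexEmbedding h6 h8 (Φ i₀) hψ₀) Φ hψ₀

/-- **Sextic fields WITHOUT pair flips** (by Dodson's dichotomy: those containing an imaginary quadratic field,
Galois closure of degree `6` or `12`): no reflex embedding into an octic field exists (`ReflexOcticPairFlips`), so the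
pair is nondegenerate iff both types are and no imaginary quadratic subfield of `K_{i₀}` embeds in `K_{i₁}`.
[cite: Dodson1984, §5.1.2] [cite: Gordon1999HodgeAVSurvey, §3 Theorem] -/
theorem isNondegenerateFamily_threefold_fourfold_iff_of_not_pairFlip {i₀ i₁ : I} (h01 : i₀ ≠ i₁)
    (hI : ∀ j, j = i₀ ∨ j = i₁) (h6 : finrank ℚ (K i₀) = 6) (h8 : finrank ℚ (K i₁) = 8)
    (hnoflip : ¬ ∀ s : K i₀ →+* ℂ, ∃ σ : ℂ ≃+* ℂ, σ • s = (starRingAut : ℂ ≃+* ℂ) • s ∧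
      ∀ t : K i₀ →+* ℂ, t ≠ s → t ≠ (starRingAut : ℂ ≃+* ℂ) • s → σ • t = t)
    (Φ : ∀ i, CMType (K i)) :
    CMAlgebra.IsNondegenerateFamily Φ ↔ (∀ i, IsNondegenerate (Φ i)) ∧
      ¬ ∃ F : IntermediateField ℚ (K i₀), finrank ℚ F = 2 ∧ IsTotallyComplex F ∧ Nonempty (F →+* K i₁) := by
  rw [isNondegenerateFamily_threefold_fourfold_iff h01 hI h6 h8 Φ]
  have hnorefl : ¬ ∃ ψ₀ : K i₁ →+* ℂ, (∀ σ : ℂ ≃+* ℂ, σ • ψ₀ = ψ₀ ↔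
      ∀ x : K i₀ →+* ℂ, σ • x ∈ (Φ i₀).1 ↔ x ∈ (Φ i₀).1) ∧
      ((ψ₀ ∈ (Φ i₁).1 ∧ ∀ (x : K i₀ →+* ℂ) (σ : ℂ ≃+* ℂ), x ∈ (Φ i₀).1 →
          σ • x = (starRingAut : ℂ ≃+* ℂ) • x →
          (∀ t : K i₀ →+* ℂ, t ≠ x → t ≠ (starRingAut : ℂ ≃+* ℂ) • x → σ • t = t) → σ • ψ₀ ∈ (Φ i₁).1) ∨
        (ψ₀ ∉ (Φ i₁).1 ∧ ∀ (x : K i₀ →+* ℂ) (σ : ℂ ≃+* ℂ), x ∈ (Φ i₀).1 →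
          σ • x = (starRingAut : ℂ ≃+* ℂ) • x →
          (∀ t : K i₀ →+* ℂ, t ≠ x → t ≠ (starRingAut : ℂ ≃+* ℂ) • x → σ • t = t) → σ • ψ₀ ∉ (Φ i₁).1)) := by
    rintro ⟨ψ₀, hψ₀, -⟩
    exact hnoflip (SexticOctic.pairFlip_of_reflexEmbedding h6 h8 (Φ i₀) hψ₀)
  simp only [hnorefl, not_false_eq_true, and_true]

end Fields

/-! ## §2 Abelian varieties: a simple CM threefold times a CM fourfold -/

section Geometry

variable {I : Type} {K : I → Type} [∀ i, Field (K i)] [∀ i, NumberField (K i)] [∀ i, IsCMField (K i)] [Fintype I]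
  [DecidableEq I] {Φ : ∀ i, CMType (K i)}
variable {A : I → AbelianVariety ℂ} {ι : ∀ i, 𝓞 (K i) →+* End (A i)}
  {θ : ∀ i, K i →+* Module.End ℂ (complexBetti (A i).X 1)}

/-- **`Hg(T × F) = Hg(T) × Hg(F)` iff …** — `T = A_{i₀}` a SIMPLE CM abelian threefold, `F = A_{i₁}` a CM abelian
fourfold, realisations of `(K_i; Φ_i)`: the pair of types is nondegenerate iff `Φ_{i₁}` is nondegenerate, no imaginary
quadratic subfield of `End⁰(T)` embeds in `End⁰(F)`, and `(Φ_{i₀}, Φ_{i₁})` is not an exotic reflex pair.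
[cite: MoonenZarhin1999LowDim, Thm. (0.2)] [cite: Gordon1999HodgeAVSurvey, §3 Theorem, 6.3 Remark, 7.5–7.7] -/
theorem isNondegenerateFamily_iff_threefold_fourfold {i₀ i₁ : I} (h01 : i₀ ≠ i₁) (hI : ∀ j, j = i₀ ∨ j = i₁)
    (hA : ∀ i, IsCMTypeRealisation (Φ i) (A i) (ι i) (θ i)) (hd₀ : (A i₀).dim = 3) (hd₁ : (A i₁).dim = 4)
    (hS₀ : (A i₀).IsSimple) :
    CMAlgebra.IsNondegenerateFamily Φ ↔ IsNondegenerate (Φ i₁) ∧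
      (¬ ∃ F : IntermediateField ℚ (K i₀), finrank ℚ F = 2 ∧ IsTotallyComplex F ∧ Nonempty (F →+* K i₁)) ∧
      ¬ ∃ ψ₀ : K i₁ →+* ℂ, (∀ σ : ℂ ≃+* ℂ, σ • ψ₀ = ψ₀ ↔ ∀ x : K i₀ →+* ℂ, σ • x ∈ (Φ i₀).1 ↔ x ∈ (Φ i₀).1) ∧
        ((ψ₀ ∈ (Φ i₁).1 ∧ ∀ (x : K i₀ →+* ℂ) (σ : ℂ ≃+* ℂ), x ∈ (Φ i₀).1 →
            σ • x = (starRingAut : ℂ ≃+* ℂ) • x →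
            (∀ t : K i₀ →+* ℂ, t ≠ x → t ≠ (starRingAut : ℂ ≃+* ℂ) • x → σ • t = t) → σ • ψ₀ ∈ (Φ i₁).1) ∨
          (ψ₀ ∉ (Φ i₁).1 ∧ ∀ (x : K i₀ →+* ℂ) (σ : ℂ ≃+* ℂ), x ∈ (Φ i₀).1 →
            σ • x = (starRingAut : ℂ ≃+* ℂ) • x →
            (∀ t : K i₀ →+* ℂ, t ≠ x → t ≠ (starRingAut : ℂ ≃+* ℂ) • x → σ • t = t) → σ • ψ₀ ∉ (Φ i₁).1)) := by
  obtain ⟨φ₀⟩ : Nonempty (K i₀ →+* ℂ) := inferInstance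
  have h6 : finrank ℚ (K i₀) = 6 := by rw [finrank_eq_two_mul_dim_of_isCMTypeRealisation (hA i₀), hd₀]
  have h8 : finrank ℚ (K i₁) = 8 := by rw [finrank_eq_two_mul_dim_of_isCMTypeRealisation (hA i₁), hd₁]
  have hnd₀ : IsNondegenerate (Φ i₀) :=
    isNondegenerate_of_isPrimitive_of_prime Nat.prime_three h6 φ₀ ((isSimple_iff_isPrimitive (hA i₀) φ₀).1 hS₀)
  rw [isNondegenerateFamily_threefold_fourfold_iff h01 hI h6 h8 Φ]
  refine ⟨fun H => ⟨H.1 i₁, H.2⟩, fun H => ⟨fun i => ?_, H.2⟩⟩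
  rcases hI i with rfl | rfl
  · exact hnd₀
  · exact H.1

/-- **The Hodge conjecture on every `T^a × F^b`** — `T` a SIMPLE CM abelian threefold, `F` a CM abelian fourfold with a
NONDEGENERATE type whose CM field receives no imaginary quadratic subfield of `End⁰(T)`, and `(Φ_T, Φ_F)` not an exotic
reflex pair: the Hodge conjecture and `B• = D•` hold on every `⨁_{j<N} A_{π j}`, UNCONDITIONALLY.
[cite: Gordon1999HodgeAVSurvey, §3 Theorem and 10.10] [cite: MoonenZarhin1999LowDim, Thm. (0.2) (4)] -/
theorem hodgeConjectureFor_prod_threefold_fourfold {i₀ i₁ : I} (h01 : i₀ ≠ i₁) (hI : ∀ j, j = i₀ ∨ j = i₁)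
    (hA : ∀ i, IsCMTypeRealisation (Φ i) (A i) (ι i) (θ i)) (hd₀ : (A i₀).dim = 3) (hd₁ : (A i₁).dim = 4)
    (hS₀ : (A i₀).IsSimple) (hnd₁ : IsNondegenerate (Φ i₁))
    (hno : ¬ ∃ F : IntermediateField ℚ (K i₀), finrank ℚ F = 2 ∧ IsTotallyComplex F ∧ Nonempty (F →+* K i₁))
    (hnoball : ¬ ∃ ψ₀ : K i₁ →+* ℂ, (∀ σ : ℂ ≃+* ℂ, σ • ψ₀ = ψ₀ ↔
        ∀ x : K i₀ →+* ℂ, σ • x ∈ (Φ i₀).1 ↔ x ∈ (Φ i₀).1) ∧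
        ((ψ₀ ∈ (Φ i₁).1 ∧ ∀ (x : K i₀ →+* ℂ) (σ : ℂ ≃+* ℂ), x ∈ (Φ i₀).1 →
            σ • x = (starRingAut : ℂ ≃+* ℂ) • x →
            (∀ t : K i₀ →+* ℂ, t ≠ x → t ≠ (starRingAut : ℂ ≃+* ℂ) • x → σ • t = t) → σ • ψ₀ ∈ (Φ i₁).1) ∨
          (ψ₀ ∉ (Φ i₁).1 ∧ ∀ (x : K i₀ →+* ℂ) (σ : ℂ ≃+* ℂ), x ∈ (Φ i₀).1 →
            σ • x = (starRingAut : ℂ ≃+* ℂ) • x →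
            (∀ t : K i₀ →+* ℂ, t ≠ x → t ≠ (starRingAut : ℂ ≃+* ℂ) • x → σ • t = t) → σ • ψ₀ ∉ (Φ i₁).1)))
    {N : ℕ} (π : Fin N → I) :
    HodgeConjectureFor (⨁ fun j : Fin N => A (π j)).dim (⨁ fun j : Fin N => A (π j)).X ∧
      ∀ m : ℕ, hodgeClassSpan (⨁ fun j : Fin N => A (π j)).dim (⨁ fun j : Fin N => A (π j)).X m =
        divisorClassesSpan (⨁ fun j : Fin N => A (π j)).X (⨁ fun j : Fin N => A (π j)).dim m := by
  haveI : Nonempty I := ⟨i₀⟩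
  have h := (isNondegenerateFamily_iff_threefold_fourfold h01 hI hA hd₀ hd₁ hS₀).2 ⟨hnd₁, hno, hnoball⟩
  exact ⟨h.hodgeConjectureFor_prod hA π, fun m => h.hodgeClassSpan_prod_eq_divisorClassesSpan hA π m⟩

/-- **`B• = D•` on EVERY `T^a × F^b` iff …** (`T` a simple CM threefold, `F` a SIMPLE CM fourfold, realisations):
iff `Φ_F` is nondegenerate, no imaginary quadratic subfield of `End⁰(T)` embeds in `End⁰(F)`, and `(Φ_T, Φ_F)` is not an
exotic reflex pair — THE COMPLETE LIST of obstructions in dimension `3 + 4`. [cite: Gordon1999HodgeAVSurvey, 7.5–7.7 and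
9.4] [cite: MoonenZarhin1999LowDim, Thm. (0.2)] -/
theorem forall_prod_hodgeClassSpan_eq_iff_threefold_fourfold {i₀ i₁ : I} (h01 : i₀ ≠ i₁) (hI : ∀ j, j = i₀ ∨ j = i₁)
    (hA : ∀ i, IsCMTypeRealisation (Φ i) (A i) (ι i) (θ i)) (hd₀ : (A i₀).dim = 3) (hd₁ : (A i₁).dim = 4)
    (hS : ∀ i, (A i).IsSimple) :
    (∀ (N : ℕ) (π : Fin N → I) (m : ℕ),
        hodgeClassSpan (⨁ fun j : Fin N => A (π j)).dim (⨁ fun j : Fin N => A (π j)).X m =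
          divisorClassesSpan (⨁ fun j : Fin N => A (π j)).X (⨁ fun j : Fin N => A (π j)).dim m) ↔
      IsNondegenerate (Φ i₁) ∧
      (¬ ∃ F : IntermediateField ℚ (K i₀), finrank ℚ F = 2 ∧ IsTotallyComplex F ∧ Nonempty (F →+* K i₁)) ∧
      ¬ ∃ ψ₀ : K i₁ →+* ℂ, (∀ σ : ℂ ≃+* ℂ, σ • ψ₀ = ψ₀ ↔ ∀ x : K i₀ →+* ℂ, σ • x ∈ (Φ i₀).1 ↔ x ∈ (Φ i₀).1) ∧
        ((ψ₀ ∈ (Φ i₁).1 ∧ ∀ (x : K i₀ →+* ℂ) (σ : ℂ ≃+* ℂ), x ∈ (Φ i₀).1 →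
            σ • x = (starRingAut : ℂ ≃+* ℂ) • x →
            (∀ t : K i₀ →+* ℂ, t ≠ x → t ≠ (starRingAut : ℂ ≃+* ℂ) • x → σ • t = t) → σ • ψ₀ ∈ (Φ i₁).1) ∨
          (ψ₀ ∉ (Φ i₁).1 ∧ ∀ (x : K i₀ →+* ℂ) (σ : ℂ ≃+* ℂ), x ∈ (Φ i₀).1 →
            σ • x = (starRingAut : ℂ ≃+* ℂ) • x →
            (∀ t : K i₀ →+* ℂ, t ≠ x → t ≠ (starRingAut : ℂ ≃+* ℂ) • x → σ • t = t) → σ • ψ₀ ∉ (Φ i₁).1)) := by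
  haveI : Nonempty I := ⟨i₀⟩
  have h6 : finrank ℚ (K i₀) = 6 := by rw [finrank_eq_two_mul_dim_of_isCMTypeRealisation (hA i₀), hd₀]
  have h8 : finrank ℚ (K i₁) = 8 := by rw [finrank_eq_two_mul_dim_of_isCMTypeRealisation (hA i₁), hd₁]
  have hsep : CMAlgebra.IsSeparatingFamily Φ :=
    isSeparatingFamily_of_isSimple_of_finrank_injective hA hS fun i j hij => by
      rcases hI i with rfl | rfl <;> rcases hI j with rfl | rfl
      · rfl
      · rw [h6, h8] at hij; omega
      · rw [h6, h8] at hij; omega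
      · rfl
  exact (CMAlgebra.isNondegenerateFamily_iff_forall_prod_hodgeClassSpan_eq hsep hA).symm.trans
    (isNondegenerateFamily_iff_threefold_fourfold h01 hI hA hd₀ hd₁ (hS i₀))

/-- **An exceptional Hodge class on some `T^a × F^b` iff `Φ_F` is degenerate, or the fields share an imaginary
quadratic subfield, or `(Φ_T, Φ_F)` is an exotic reflex pair** (`T`, `F` simple; the classes are not claimed algebraic
or non-algebraic here). [cite: Gordon1999HodgeAVSurvey, 7.5–7.7 and 9.4] [cite: MoonenZarhin1999LowDim, Thm. (0.2)] -/
theorem exists_exceptional_prod_iff_threefold_fourfold {i₀ i₁ : I} (h01 : i₀ ≠ i₁) (hI : ∀ j, j = i₀ ∨ j = i₁)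
    (hA : ∀ i, IsCMTypeRealisation (Φ i) (A i) (ι i) (θ i)) (hd₀ : (A i₀).dim = 3) (hd₁ : (A i₁).dim = 4)
    (hS : ∀ i, (A i).IsSimple) :
    (∃ (N : ℕ) (π : Fin N → I) (m : ℕ) (c : complexBetti (⨁ fun j : Fin N => A (π j)).X (2 * m)),
        IsRationalClass c ∧
        IsOfHodgeType (⨁ fun j : Fin N => A (π j)).dim (⨁ fun j : Fin N => A (π j)).X (2 * m) m m c ∧
        c ∉ divisorClassesSpan (⨁ fun j : Fin N => A (π j)).X (⨁ fun j : Fin N => A (π j)).dim m) ↔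
      ¬ IsNondegenerate (Φ i₁) ∨
      (∃ F : IntermediateField ℚ (K i₀), finrank ℚ F = 2 ∧ IsTotallyComplex F ∧ Nonempty (F →+* K i₁)) ∨
      ∃ ψ₀ : K i₁ →+* ℂ, (∀ σ : ℂ ≃+* ℂ, σ • ψ₀ = ψ₀ ↔ ∀ x : K i₀ →+* ℂ, σ • x ∈ (Φ i₀).1 ↔ x ∈ (Φ i₀).1) ∧
        ((ψ₀ ∈ (Φ i₁).1 ∧ ∀ (x : K i₀ →+* ℂ) (σ : ℂ ≃+* ℂ), x ∈ (Φ i₀).1 →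
            σ • x = (starRingAut : ℂ ≃+* ℂ) • x →
            (∀ t : K i₀ →+* ℂ, t ≠ x → t ≠ (starRingAut : ℂ ≃+* ℂ) • x → σ • t = t) → σ • ψ₀ ∈ (Φ i₁).1) ∨
          (ψ₀ ∉ (Φ i₁).1 ∧ ∀ (x : K i₀ →+* ℂ) (σ : ℂ ≃+* ℂ), x ∈ (Φ i₀).1 →
            σ • x = (starRingAut : ℂ ≃+* ℂ) • x →
            (∀ t : K i₀ →+* ℂ, t ≠ x → t ≠ (starRingAut : ℂ ≃+* ℂ) • x → σ • t = t) → σ • ψ₀ ∉ (Φ i₁).1)) := by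
  haveI : Nonempty I := ⟨i₀⟩
  have h6 : finrank ℚ (K i₀) = 6 := by rw [finrank_eq_two_mul_dim_of_isCMTypeRealisation (hA i₀), hd₀]
  have h8 : finrank ℚ (K i₁) = 8 := by rw [finrank_eq_two_mul_dim_of_isCMTypeRealisation (hA i₁), hd₁]
  have hsep : CMAlgebra.IsSeparatingFamily Φ :=
    isSeparatingFamily_of_isSimple_of_finrank_injective hA hS fun i j hij => by
      rcases hI i with rfl | rfl <;> rcases hI j with rfl | rfl
      · rfl
      · rw [h6, h8] at hij; omega
      · rw [h6, h8] at hij; omega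
      · rfl
  have key := isNondegenerateFamily_iff_threefold_fourfold h01 hI hA hd₀ hd₁ (hS i₀)
  constructor
  · rintro ⟨N, π, m, c, hc, hpq, hnot⟩
    by_contra hcon
    simp only [not_or, not_not] at hcon
    obtain ⟨h1, h2, h3⟩ := hcon
    exact (key.2 ⟨h1, h2, h3⟩).not_exists_exceptional_prod hA π m ⟨c, hc, hpq, hnot⟩
  · intro hor
    refine CMAlgebra.exists_exceptional_prod_of_not_isNondegenerateFamily hsep (fun hnd => ?_) hA
    obtain ⟨h1, h2, h3⟩ := key.1 hnd
    rcases hor with h | h | h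
    · exact h h1
    · exact h2 h
    · exact h3 h

/-- **A simple CM threefold whose sextic field has NO pair flips (contains an imaginary quadratic field) times a CM
fourfold with a nondegenerate type**: the Hodge conjecture and `B• = D•` on every `T^a × F^b` as soon as no imaginary
quadratic subfield of `End⁰(T)` embeds in `End⁰(F)` — no reflex configuration can occur.
[cite: Gordon1999HodgeAVSurvey, §3 Theorem and 10.10] [cite: Dodson1984, §5.1.2] -/
theorem hodgeConjectureFor_prod_threefold_fourfold_of_not_pairFlip {i₀ i₁ : I} (h01 : i₀ ≠ i₁)
    (hI : ∀ j, j = i₀ ∨ j = i₁) (hA : ∀ i, IsCMTypeRealisation (Φ i) (A i) (ι i) (θ i)) (hd₀ : (A i₀).dim = 3)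
    (hd₁ : (A i₁).dim = 4) (hS₀ : (A i₀).IsSimple) (hnd₁ : IsNondegenerate (Φ i₁))
    (hnoflip : ¬ ∀ s : K i₀ →+* ℂ, ∃ σ : ℂ ≃+* ℂ, σ • s = (starRingAut : ℂ ≃+* ℂ) • s ∧
      ∀ t : K i₀ →+* ℂ, t ≠ s → t ≠ (starRingAut : ℂ ≃+* ℂ) • s → σ • t = t)
    (hno : ¬ ∃ F : IntermediateField ℚ (K i₀), finrank ℚ F = 2 ∧ IsTotallyComplex F ∧ Nonempty (F →+* K i₁))
    {N : ℕ} (π : Fin N → I) :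
    HodgeConjectureFor (⨁ fun j : Fin N => A (π j)).dim (⨁ fun j : Fin N => A (π j)).X ∧
      ∀ m : ℕ, hodgeClassSpan (⨁ fun j : Fin N => A (π j)).dim (⨁ fun j : Fin N => A (π j)).X m =
        divisorClassesSpan (⨁ fun j : Fin N => A (π j)).X (⨁ fun j : Fin N => A (π j)).dim m := by
  haveI : Nonempty I := ⟨i₀⟩
  obtain ⟨φ₀⟩ : Nonempty (K i₀ →+* ℂ) := inferInstance
  have h6 : finrank ℚ (K i₀) = 6 := by rw [finrank_eq_two_mul_dim_of_isCMTypeRealisation (hA i₀), hd₀]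
  have h8 : finrank ℚ (K i₁) = 8 := by rw [finrank_eq_two_mul_dim_of_isCMTypeRealisation (hA i₁), hd₁]
  have hnd₀ : IsNondegenerate (Φ i₀) :=
    isNondegenerate_of_isPrimitive_of_prime Nat.prime_three h6 φ₀ ((isSimple_iff_isPrimitive (hA i₀) φ₀).1 hS₀)
  have hnd : ∀ i, IsNondegenerate (Φ i) := fun i => by
    rcases hI i with rfl | rfl
    · exact hnd₀
    · exact hnd₁
  have h := (isNondegenerateFamily_threefold_fourfold_iff_of_not_pairFlip h01 hI h6 h8 hnoflip Φ).2 ⟨hnd, hno⟩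
  exact ⟨h.hodgeConjectureFor_prod hA π, fun m => h.hodgeClassSpan_prod_eq_divisorClassesSpan hA π m⟩

end Geometry

end Summit.HodgeConjecture.CorCM

end
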